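import Literature.Geometry.Lorentzian.KerrConvergenceProofs
import Literature.Geometry.Lorentzian.CausalityProofs
import Literature.Geometry.Lorentzian.MinkowskiCauchy
import Mathlib.Analysis.SpecialFunctions.Trigonometric.ArctanDeriv

/-!
# Route EIHFluxBalance — `InertialRecession`, re-charting: lab-time causality orients the lab chart

Helper file for the crux `stmt-FinalStateConjecture-10166`
(`Summit.FinalStateConjecture.FinalStateConjecture.Theses.EIHFluxBalance.InertialRecession`),
stub `stub_rechart` of line `sublinear-is-free-clean-window-charges`.

The re-charting theorem `inertialRecession_spinZero_of_causal` takes as a hypothesis that the lab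
chart `Φ` is FUTURE-ORIENTED at late guaranteed points: every chart-timelike push-forward `dΦ_x w`
with `w⁰ > 0` is future-directed. This file derives that clause from the registered hypothesis of
`stub_rechart`, EVENTUAL LAB-TIME CAUSALITY (`Φ y ∈ J⁺(Φ x) ⇒ x⁰ ≤ y⁰` for late guaranteed
`x, y`):

* `isFutureDirected_mfderiv_of_labTimeCausality` — abstract form: `Φ : U → M` smooth, `S ⊆ U` open
  with lab-time causality on `S`; if `dΦ_x w` (`x ∈ S`, `w⁰ > 0`) is timelike it is future-directed.
  Proof: otherwise `dΦ_x(−w)` is future timelike, and so is the velocity of the receding chart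
  segment `σ ↦ Φ(x − (δ arctan σ) w)` for small `σ ≥ 0`, by continuity of `g(γ', γ')` and
  `g(T, γ')` along the (smooth) curve (`LorentzianMetric.continuous_tangentLift`,
  `continuous_val_of_continuous`); its endpoint lies in `J⁺(Φ x)` at a smaller lab time —
  contradicting lab-time causality.
* `isOpen_setOf_lt_radius_poincareInv` — the late guaranteed lab region
  `{T < x⁰, rinᵢ < rᵢ(x) ∀ i}` of the crux antecedent is open (continuity of the painted radii:
  inversion is continuous on the Lorentz frames, `contDiffAt_map_inverse`).
* `velocity_comp_smooth_curve` — velocity of `Φ ∘ p` for a smooth curve `p` through `U`.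

[O'Neill 1983, Ch. 5, p. 145 (future/past dichotomy of causal vectors); Ch. 14, pp. 402–403;
folklore causal bookkeeping]
-/

noncomputable section

set_option linter.dupNamespace false

open Set Filter Topology Function TopologicalSpace Literature.Geometry.Lorentzian
open scoped Manifold ContDiff

namespace Summit.FinalStateConjecture.FinalStateConjecture.Theorems

variable {𝓢 : Spacetime 4} {U : Opens E4}

/-- **Velocity of the chart image of a smooth curve through `U`.** For `p : ℝ → U ⊆ E4` smooth with
`p'(σ) = v`, the curve `s ↦ Φ(p s)` is differentiable at `σ` with velocity `dΦ_{p σ}(v)`.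
[folklore] -/
theorem velocity_comp_smooth_curve {Φ : U → 𝓢.carrier} (hΦ : ContMDiff 𝓘(ℝ, E4) (𝓡 4) ∞ Φ)
    {p : ℝ → E4} (hp : ContDiff ℝ ∞ p) (hpU : ∀ s, p s ∈ (U : Set E4)) {σ : ℝ} {v : E4}
    (hv : HasDerivAt p v σ) :
    MDifferentiableAt 𝓘(ℝ, ℝ) (𝓡 4) (fun s ↦ Φ ⟨p s, hpU s⟩) σ ∧
      velocity (𝓡 4) (fun s ↦ Φ ⟨p s, hpU s⟩) σ =
        mfderiv 𝓘(ℝ, E4) (𝓡 4) Φ ⟨p σ, hpU σ⟩ v := by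
  set c : ℝ → U := fun s ↦ ⟨p s, hpU s⟩ with hc
  have hval : ContMDiff 𝓘(ℝ, ℝ) 𝓘(ℝ, E4) ∞ (Subtype.val ∘ c) := contMDiff_iff_contDiff.mpr hp
  have hcs : ContMDiff 𝓘(ℝ, ℝ) 𝓘(ℝ, E4) ∞ c := (ContMDiff.subtypeVal_comp_iff U c).1 hval
  have h2 : MDifferentiableAt 𝓘(ℝ, ℝ) 𝓘(ℝ, E4) c σ := hcs.mdifferentiableAt (by simp)
  have h3 : MDifferentiableAt 𝓘(ℝ, E4) (𝓡 4) Φ (c σ) := hΦ.mdifferentiableAt (by simp)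
  refine ⟨h3.comp σ h2, ?_⟩
  have hvel : mfderiv 𝓘(ℝ, ℝ) 𝓘(ℝ, E4) c σ (1 : ℝ) = v := by
    have h1 : MDifferentiableAt 𝓘(ℝ, E4) 𝓘(ℝ, E4) (Subtype.val : U → E4) (c σ) :=
      (contMDiff_subtype_val (n := ∞)).mdifferentiableAt (by simp)
    have hcomp := mfderiv_comp σ h1 h2
    have hfd : mfderiv 𝓘(ℝ, ℝ) 𝓘(ℝ, E4) (Subtype.val ∘ c) σ (1 : ℝ) = v := by
      rw [mfderiv_eq_fderiv, show (Subtype.val ∘ c) = p from rfl, hv.hasFDerivAt.fderiv]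
      show (1 : ℝ) • v = v
      exact one_smul ℝ v
    rw [hcomp] at hfd
    have e1 := OpensChart.mfderiv_subtypeVal_apply (c σ) (mfderiv 𝓘(ℝ, ℝ) 𝓘(ℝ, E4) c σ (1 : ℝ))
    exact e1.symm.trans hfd
  have hcomp2 := mfderiv_comp σ h3 h2
  unfold velocity
  rw [show (fun s ↦ Φ ⟨p s, hpU s⟩) = Φ ∘ c from rfl, hcomp2]
  show mfderiv 𝓘(ℝ, E4) (𝓡 4) Φ (c σ) (mfderiv 𝓘(ℝ, ℝ) 𝓘(ℝ, E4) c σ (1 : ℝ)) = _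
  rw [hvel]

/-- **Lab-time causality orients the lab chart.** Let `Φ : U → M` be smooth and `S ⊆ U` open, and
suppose lab time is causal on `S`: `Φ y ∈ J⁺(Φ x) ⇒ x⁰ ≤ y⁰` for `x, y ∈ S`. Then at every
`x ∈ S`, a chart vector `w` with `w⁰ > 0` whose push-forward `dΦ_x w` is timelike has `dΦ_x w`
FUTURE-directed. (Otherwise `dΦ_x(−w)` is future timelike; by continuity of `g(γ', γ')` and
`g(T, γ')` along the smooth receding segment `γ(σ) = Φ(x − (δ arctan σ) w)` this stays so for
`σ ∈ [0, σ₁]`, giving a future causal curve from `Φ x` to a point of `Φ(S)` with smaller lab time.)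
O'Neill 1983, Ch. 5, p. 145; Ch. 14, pp. 402–403. [folklore] -/
theorem isFutureDirected_mfderiv_of_labTimeCausality {Φ : U → 𝓢.carrier}
    (hΦ : ContMDiff 𝓘(ℝ, E4) (𝓡 4) ∞ Φ) {S : Set E4} (hS : IsOpen S) (hSU : S ⊆ (U : Set E4))
    (hT : ∀ x y : U, x.1 ∈ S → y.1 ∈ S →
      Φ y ∈ 𝓢.metric.causalFuture 𝓢.timeOrientation {Φ x} → x.1 0 ≤ y.1 0)
    (x : U) (hx : x.1 ∈ S) {w : E4} (hw : 0 < w 0)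
    (htl : 𝓢.metric.val (Φ x) (mfderiv 𝓘(ℝ, E4) (𝓡 4) Φ x w)
      (mfderiv 𝓘(ℝ, E4) (𝓡 4) Φ x w) < 0) :
    𝓢.timeOrientation.IsFutureDirected (mfderiv 𝓘(ℝ, E4) (𝓡 4) Φ x w) := by
  have hcausal : 𝓢.metric.IsCausal (mfderiv 𝓘(ℝ, E4) (𝓡 4) Φ x w) :=
    (show 𝓢.metric.IsTimelike _ from htl).isCausal
  rcases 𝓢.timeOrientation.isFutureDirected_or_isPastDirected_of_isCausal hcausal with hf | hpast
  · exact hf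
  exfalso
  -- a ball of `S` about `x`, and the scale `δ`
  obtain ⟨ρ, hρ, hball⟩ := Metric.isOpen_iff.mp hS x.1 hx
  set δ : ℝ := ρ / (2 * (‖w‖ + 1)) with hδ
  have hδ0 : 0 < δ := by positivity
  have hδw : δ * 2 * ‖w‖ < ρ := by
    rw [hδ, div_mul_eq_mul_div, div_mul_eq_mul_div, div_lt_iff₀ (by positivity)]
    nlinarith [norm_nonneg w]
  -- the receding chart segment `p σ = x − (δ arctan σ) w`
  set p : ℝ → E4 := fun σ ↦ x.1 - (δ * Real.arctan σ) • w with hpdef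
  have hpS : ∀ σ, p σ ∈ S := by
    intro σ
    apply hball
    rw [Metric.mem_ball, dist_eq_norm]
    show ‖(x.1 - (δ * Real.arctan σ) • w) - x.1‖ < ρ
    rw [sub_sub_cancel_left, norm_neg, norm_smul, Real.norm_eq_abs, abs_mul, abs_of_pos hδ0]
    have h1 : |Real.arctan σ| ≤ 2 := by
      rw [abs_le]
      constructor <;>
        linarith [Real.arctan_lt_pi_div_two σ, Real.neg_pi_div_two_lt_arctan σ, Real.pi_le_four]
    calc δ * |Real.arctan σ| * ‖w‖ ≤ δ * 2 * ‖w‖ := by gcongr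
      _ < ρ := hδw
  have hpU : ∀ σ, p σ ∈ (U : Set E4) := fun σ ↦ hSU (hpS σ)
  have hp : ContDiff ℝ ∞ p :=
    contDiff_const.sub ((contDiff_const.mul Real.contDiff_arctan).smul contDiff_const)
  have hpd : ∀ σ, HasDerivAt p ((δ / (1 + σ ^ 2)) • (-w)) σ := by
    intro σ
    have h1 : HasDerivAt (fun s ↦ δ * Real.arctan s) (δ * (1 / (1 + σ ^ 2))) σ :=
      (Real.hasDerivAt_arctan σ).const_mul δ
    have h2 := (h1.smul_const w).const_sub x.1
    refine h2.congr_deriv ?_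
    rw [mul_one_div, smul_neg]
  -- the curve and its velocity
  have hvel : ∀ σ, MDifferentiableAt 𝓘(ℝ, ℝ) (𝓡 4) (fun s ↦ Φ ⟨p s, hpU s⟩) σ ∧
      velocity (𝓡 4) (fun s ↦ Φ ⟨p s, hpU s⟩) σ =
        (δ / (1 + σ ^ 2)) • mfderiv 𝓘(ℝ, E4) (𝓡 4) Φ ⟨p σ, hpU σ⟩ (-w) := by
    intro σ
    obtain ⟨hd, hv⟩ := velocity_comp_smooth_curve hΦ hp hpU (hpd σ)
    refine ⟨hd, ?_⟩
    rw [hv]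
    exact (mfderiv 𝓘(ℝ, E4) (𝓡 4) Φ ⟨p σ, hpU σ⟩).map_smul _ _
  have hγs : ContMDiff 𝓘(ℝ, ℝ) (𝓡 4) ∞ (fun s ↦ Φ ⟨p s, hpU s⟩) := by
    have hcs : ContMDiff 𝓘(ℝ, ℝ) 𝓘(ℝ, E4) ∞ (fun s ↦ (⟨p s, hpU s⟩ : U)) :=
      (ContMDiff.subtypeVal_comp_iff U _).1 (contMDiff_iff_contDiff.mpr hp)
    exact hΦ.comp hcs
  have hγc : Continuous (fun s ↦ Φ ⟨p s, hpU s⟩) := hγs.continuous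
  have hlift := LorentzianMetric.continuous_tangentLift (I := 𝓡 4)
    (hγs.of_le (by exact_mod_cast le_top))
  have hTl : Continuous (fun s ↦ ((⟨Φ ⟨p s, hpU s⟩,
      𝓢.timeOrientation.vectorField (Φ ⟨p s, hpU s⟩)⟩ : TangentBundle (𝓡 4) 𝓢.carrier))) :=
    (contMDiff_zero_iff.mp (𝓢.timeOrientation.contMDiff.of_le bot_le)).comp hγc
  have hF := 𝓢.metric.continuous_val_of_continuous hγc hlift hlift
  have hF₂ := 𝓢.metric.continuous_val_of_continuous hγc hTl hlift
  -- values at `σ = 0`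
  have hp0 : p 0 = x.1 := by simp [hpdef, Real.arctan_zero]
  have hc0 : (⟨p 0, hpU 0⟩ : U) = x := Subtype.ext hp0
  have key : ∀ z : U, z = x →
      𝓢.metric.val (Φ z) (mfderiv 𝓘(ℝ, E4) (𝓡 4) Φ z (-w)) (mfderiv 𝓘(ℝ, E4) (𝓡 4) Φ z (-w)) < 0 ∧
        𝓢.metric.val (Φ z) (𝓢.timeOrientation.vectorField (Φ z))
          (mfderiv 𝓘(ℝ, E4) (𝓡 4) Φ z (-w)) < 0 := by
    rintro z rfl
    have e : mfderiv 𝓘(ℝ, E4) (𝓡 4) Φ z (-w) = -(mfderiv 𝓘(ℝ, E4) (𝓡 4) Φ z w) := map_neg _ _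
    rw [e]
    refine ⟨?_, ?_⟩
    · simpa using htl
    · rw [map_neg, neg_lt_zero]
      exact hpast.2
  obtain ⟨hQ0, hP0⟩ := key _ hc0
  have hF0 : 𝓢.metric.val (Φ ⟨p 0, hpU 0⟩) (velocity (𝓡 4) (fun s ↦ Φ ⟨p s, hpU s⟩) 0)
      (velocity (𝓡 4) (fun s ↦ Φ ⟨p s, hpU s⟩) 0) < 0 := by
    rw [(hvel 0).2]
    simp only [map_smul, FunLike.coe_smul, Pi.smul_apply, smul_eq_mul]
    have hc : 0 < δ / (1 + (0 : ℝ) ^ 2) := by positivity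
    exact mul_neg_of_pos_of_neg hc (mul_neg_of_pos_of_neg hc hQ0)
  have hF₂0 : 𝓢.metric.val (Φ ⟨p 0, hpU 0⟩) (𝓢.timeOrientation.vectorField (Φ ⟨p 0, hpU 0⟩))
      (velocity (𝓡 4) (fun s ↦ Φ ⟨p s, hpU s⟩) 0) < 0 := by
    rw [(hvel 0).2]
    simp only [map_smul, smul_eq_mul]
    have hc : 0 < δ / (1 + (0 : ℝ) ^ 2) := by positivity
    exact mul_neg_of_pos_of_neg hc hP0
  -- a parameter `σ₁ > 0` up to which both signs persist
  have hev := ((hF.continuousAt (x := 0)).eventually_lt_const hF0).and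
    ((hF₂.continuousAt (x := 0)).eventually_lt_const hF₂0)
  obtain ⟨ε, hε, hεP⟩ := Metric.eventually_nhds_iff.mp hev
  set σ₁ : ℝ := ε / 2 with hσ₁
  have hσ₁0 : 0 < σ₁ := by positivity
  have hcurve : 𝓢.metric.IsFutureCausalCurveOn 𝓢.timeOrientation (fun s ↦ Φ ⟨p s, hpU s⟩)
      (Icc 0 σ₁) := by
    intro σ hσ
    have hσε : dist σ 0 < ε := by
      rw [dist_zero_right, Real.norm_eq_abs, abs_of_nonneg hσ.1]; linarith [hσ.2]
    obtain ⟨hQ, hP⟩ := hεP hσε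
    exact ⟨(hvel σ).1, (show 𝓢.metric.IsTimelike _ from hQ).isCausal, hP⟩
  -- the endpoint is in `J⁺(Φ x)` at a smaller lab time
  have hγ0 : (fun s ↦ Φ ⟨p s, hpU s⟩) 0 = Φ x := by
    show Φ ⟨p 0, hpU 0⟩ = Φ x
    rw [hc0]
  have hJ : Φ ⟨p σ₁, hpU σ₁⟩ ∈ 𝓢.metric.causalFuture 𝓢.timeOrientation {Φ x} :=
    Or.inr ⟨Φ x, mem_singleton _, fun s ↦ Φ ⟨p s, hpU s⟩, 0, σ₁, hσ₁0, hcurve, hγ0, rfl⟩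
  have hle := hT x ⟨p σ₁, hpU σ₁⟩ hx (hpS σ₁) hJ
  change x.1 0 ≤ p σ₁ 0 at hle
  have hp1 : p σ₁ 0 = x.1 0 - δ * Real.arctan σ₁ * w 0 := by
    simp only [hpdef, WithLp.ofLp_sub, WithLp.ofLp_smul, Pi.sub_apply, Pi.smul_apply, smul_eq_mul]
  have harc : 0 < Real.arctan σ₁ := Real.arctan_pos.2 hσ₁0
  rw [hp1] at hle
  nlinarith [mul_pos (mul_pos hδ0 harc) hw]

/-- **The late guaranteed lab region is open.** For continuous centres `ξᵢ` and frames `Λᵢ`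
(continuous as operator-valued maps), the set `{x | T < x⁰ ∧ ∀ i, rinᵢ < rᵢ(x)}` of the crux
antecedent — `rᵢ(x)` the painted Kerr–Schild radius `r_{aᵢ}(Λᵢ(x⁰)⁻¹(x − (x⁰, ξᵢ(x⁰))))` — is open:
the painted radii are continuous (inversion is continuous at the invertible frames, Mathlib
`contDiffAt_map_inverse`; `Kerr.continuous_radius`). [folklore] -/
theorem isOpen_setOf_lt_radius_poincareInv {N : ℕ} (a rin : Fin N → ℝ)
    (Λ : Fin N → ℝ → lorentzGroup) (ξ : Fin N → ℝ → E3) (T : ℝ)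
    (hΛ : ∀ i, Continuous fun t ↦ ((Λ i t : E4 ≃L[ℝ] E4) : E4 →L[ℝ] E4))
    (hξ : ∀ i, Continuous (ξ i)) :
    IsOpen {z : E4 | T < z 0 ∧ ∀ i, rin i <
      Kerr.radius (a i) (poincareInv (Λ i (z 0)) (E4.ofTimeSpace (z 0) (ξ i (z 0))) z)} := by
  have h0 : Continuous fun z : E4 ↦ z 0 := (EuclideanSpace.proj (0 : Fin 4) : E4 →L[ℝ] ℝ).continuous
  have hrad : ∀ i, Continuous fun z : E4 ↦
      Kerr.radius (a i) (poincareInv (Λ i (z 0)) (E4.ofTimeSpace (z 0) (ξ i (z 0))) z) := by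
    intro i
    -- the inverse frame is continuous in time
    have hinv : Continuous fun t : ℝ ↦ (((Λ i t : E4 ≃L[ℝ] E4).symm : E4 ≃L[ℝ] E4) : E4 →L[ℝ] E4) := by
      have he : (fun t : ℝ ↦ (((Λ i t : E4 ≃L[ℝ] E4).symm : E4 ≃L[ℝ] E4) : E4 →L[ℝ] E4)) =
          ContinuousLinearMap.inverse ∘ fun t ↦ ((Λ i t : E4 ≃L[ℝ] E4) : E4 →L[ℝ] E4) := by
        funext t
        simp only [comp_apply, ContinuousLinearMap.inverse_equiv]
      rw [he]
      exact continuous_iff_continuousAt.2 fun t ↦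
        ContinuousAt.comp (f := fun s : ℝ ↦ ((Λ i s : E4 ≃L[ℝ] E4) : E4 →L[ℝ] E4)) (x := t)
          (contDiffAt_map_inverse (n := 0) (Λ i t : E4 ≃L[ℝ] E4)).continuousAt
          (hΛ i).continuousAt
    have hc : Continuous fun z : E4 ↦ E4.ofTimeSpace (z 0) (ξ i (z 0)) := by
      have : (fun z : E4 ↦ E4.ofTimeSpace (z 0) (ξ i (z 0))) =
          fun z ↦ (z 0) • E4.basisVector 0 + E4.ofTimeSpace 0 (ξ i (z 0)) :=
        funext fun z ↦ E4.ofTimeSpace_eq_smul_add _ _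
      rw [this]
      exact (h0.smul continuous_const).add ((E4.continuous_ofTimeSpace 0).comp ((hξ i).comp h0))
    have happ : Continuous fun z : E4 ↦ (((Λ i (z 0) : E4 ≃L[ℝ] E4).symm : E4 ≃L[ℝ] E4) : E4 →L[ℝ] E4)
        (z - E4.ofTimeSpace (z 0) (ξ i (z 0))) :=
      (hinv.comp h0).clm_apply (continuous_id.sub hc)
    exact (Kerr.continuous_radius (a i)).comp happ
  simp only [Set.setOf_and, Set.setOf_forall]
  exact (isOpen_lt continuous_const h0).inter
    (isOpen_iInter_of_finite fun i ↦ isOpen_lt continuous_const (hrad i))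

/-- One-line form of `isOpen_setOf_lt_radius_poincareInv` (registered helper stub
`isOpen_lateGuaranteed_rechart` of the crux item). [folklore] -/
theorem isOpen_lateGuaranteed_rechart : open Literature.Geometry.Lorentzian in ∀ {N : ℕ} (a rin : Fin N → ℝ) (Λ : Fin N → ℝ → lorentzGroup) (ξ : Fin N → ℝ → E3) (T : ℝ), (∀ i, Continuous fun t ↦ ((Λ i t : E4 ≃L[ℝ] E4) : E4 →L[ℝ] E4)) → (∀ i, Continuous (ξ i)) → IsOpen {z : E4 | T < z 0 ∧ ∀ i, rin i < Kerr.radius (a i) (poincareInv (Λ i (z 0)) (E4.ofTimeSpace (z 0) (ξ i (z 0))) z)} :=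
  fun a rin Λ ξ T hΛ hξ ↦ isOpen_setOf_lt_radius_poincareInv a rin Λ ξ T hΛ hξ

end Summit.FinalStateConjecture.FinalStateConjecture.Theorems
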